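import Literature.NumberTheory.LFunctions.MauduitRivatFourier
import Literature.NumberTheory.Sieve.BombieriFriedlanderIwaniecDispersionSeparation
import HarnessLib

/-!
# Completing the type-I inner sum by the discrete Fourier transform (Mauduit–Rivat 2015, (31)–(32); proved)

Everything in this file is PROVED. It formalises the opening step of the proof of the type-I
estimate of C. Mauduit, J. Rivat, *Prime numbers along Rudin–Shapiro sequences*, J. Eur.
Math. Soc. 17 (2015), Prop. 1 (pp. 2605–2606): "Let `0 ≤ ℓ < q^{μ+ν}`. For `M/q < m ≤ M`, we
have `ℓ = mn` with `mn ∈ I(M,N)` if and only if `ℓ ∈ I(M,N)` and `ℓ ≡ 0 mod m`. Therefore the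
inner sum (over `n`) in `S_I(ϑ)` is
`∑_{u∈I} ∑_{ℓ<q^{μ+ν}} f(ℓ)e(ϑℓ) (q^{-μ-ν} ∑_h e(h(u−ℓ)/q^{μ+ν})) (m⁻¹ ∑_{k<m} e(kℓ/m))` …
`S_I(ϑ) ≤ ∑_{h<q^{μ+ν}} min(q^{μ+ν}, |sin(πh/q^{μ+ν})|⁻¹) S_I'(h − ϑq^{μ+ν})` (31), where
`S_I'(ϑ') = ∑_m m⁻¹ ∑_{k<m} |f̂_{μ+ν}(ϑ' − k q^{μ+ν}/m)|`, which gives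
`S_I(ϑ) ≪ max_{ϑ'} S_I'(ϑ') q^{μ+ν} log q^{μ+ν}` (32)",
for a weight `F` with values in a complex normed space `E` (the matrix-valued setting of
C. Müllner, Duke Math. J. 166 (2017), Thm. 4.4), with `K` in place of `q^{μ+ν}`, an arbitrary
finite set of moduli `m ≥ 1`, the phase `e(ϑℓ)` absorbed into `F` (`dftR_fourierChar_smul`),
and the kernel `min(#I, 1/(2‖h/K‖))` (`Sieve.Vinogradov.geomBound`) for MR's `min(K, |sin|⁻¹)`:

* `sum_filter_dvd_eq_dft` — the exact identity behind (31):
  `∑_{ℓ∈(A,B], m∣ℓ} F(ℓ) = ∑_{h<K} C(h) • m⁻¹ ∑_{k<m} dftR K F (−h − kK/m)`,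
  `C(h) = ∑_{s∈(A,B]} e(−hs/K)`, valid for `B < K`;
* `norm_sum_filter_dvd_le` — (31):
  `‖∑_{ℓ∈(A,B], m∣ℓ} F(ℓ)‖ ≤ ∑_{h<K} min(V, 1/(2‖h/K‖)) · m⁻¹ ∑_{k<m} ‖dftR K F (−h − kK/m)‖`
  (`B − A ≤ V`);
* `sum_norm_sum_filter_dvd_le` — (32): if `∑_m m⁻¹ ∑_{k<m} ‖dftR K F (t − kK/m)‖ ≤ S` for every
  real `t`, then `∑_m ‖∑_{ℓ∈(A,B], m∣ℓ} F(ℓ)‖ ≤ (2V + K(1 + log K)) · S`.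

## References
* C. Mauduit, J. Rivat, J. Eur. Math. Soc. 17 (2015) 2595–2642, proof of Prop. 1, (31)–(32),
  pp. 2605–2606. [MauduitRivat2015]
* C. Müllner, Duke Math. J. 166 (2017) 3219–3290, Thm. 4.4 (arXiv:1602.03042, p. 20). [Mullner2017]
-/

noncomputable section

open Finset Complex
open scoped FourierTransform

namespace Literature.NumberTheory.LFunctions.MauduitRivat

open Literature.NumberTheory.Sieve.Vinogradov (geomBound geomBound_nonneg geomBound_neg
  norm_sum_Ioc_fourierChar_le_geomBound)
open Literature.NumberTheory.Sieve.BFI (indicator_Ioc_eq_sum_e sum_range_geomBound_div_le)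
open Literature.NumberTheory.Sieve.RamanujanSum (sum_range_fourierChar_div)

variable {E : Type*} [NormedAddCommGroup E] [NormedSpace ℂ E]

/-! ## Absorbing the phase `e(ϑℓ)` -/

/-- `dftR K (ℓ ↦ e(ϑℓ) F(ℓ)) t = dftR K F (t − Kϑ)`: the twist by `e(ϑ·)` shifts the frequency
(this is why (31) has `S_I'(h − ϑ q^{μ+ν})`). [cite: MauduitRivat2015, (31)] -/
theorem dftR_fourierChar_smul (K : ℕ) (F : ℕ → E) (θ t : ℝ) :
    dftR K (fun ℓ => (𝐞 (θ * ℓ) : ℂ) • F ℓ) t = dftR K F (t - K * θ) := by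
  simp only [dftR_apply, smul_smul]
  rcases Nat.eq_zero_or_pos K with rfl | hK
  · simp
  have hK0 : (K : ℝ) ≠ 0 := by exact_mod_cast hK.ne'
  congr 1
  refine sum_congr rfl fun u _ => ?_
  rw [coe_fourierChar_mul]
  congr 3
  field_simp
  ring

/-! ## Detecting `m ∣ ℓ` and `ℓ ∈ (A, B]` by additive characters -/

/-- `m⁻¹ ∑_{k<m} e(kℓ/m) = [m ∣ ℓ]` (`m ≥ 1`, natural `ℓ`). [folklore] -/
theorem inv_mul_sum_range_fourierChar_div_nat {m : ℕ} (hm : 0 < m) (ℓ : ℕ) :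
    ((m : ℂ)⁻¹) * ∑ k ∈ range m, (𝐞 ((k : ℝ) * ℓ / m) : ℂ) = if m ∣ ℓ then 1 else 0 := by
  have h := sum_range_fourierChar_div hm.ne' (ℓ : ℤ)
  have hm0 : (m : ℂ) ≠ 0 := by exact_mod_cast hm.ne'
  have e : ∑ k ∈ range m, (𝐞 ((k : ℝ) * ℓ / m) : ℂ) =
      ∑ k ∈ range m, (𝐞 ((k : ℝ) * ((ℓ : ℤ) : ℝ) / m) : ℂ) := by simp
  rw [e, h]
  by_cases hd : m ∣ ℓ
  · rw [if_pos (Int.natCast_dvd_natCast.2 hd), if_pos hd, inv_mul_cancel₀ hm0]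
  · rw [if_neg (fun h' => hd (Int.natCast_dvd_natCast.1 h')), if_neg hd, mul_zero]

/-- The triple-sum expansion of the right-hand side of (31): for any coefficients `C`,
`∑_{h<K} C(h) • m⁻¹ ∑_{k<m} dftR K F (−h − kK/m)
   = ∑_{ℓ<K} (∑_{h<K} ∑_{k<m} K⁻¹ m⁻¹ C(h) e(hℓ/K) e(kℓ/m)) • F(ℓ)`. [folklore] -/
theorem sum_smul_dftR_shift_eq {K m : ℕ} (hK : 0 < K) (hm : 0 < m) (C : ℕ → ℂ) (F : ℕ → E) :
    ∑ h ∈ range K, C h • (((m : ℂ)⁻¹) • ∑ k ∈ range m, dftR K F (-(h : ℝ) - (k : ℝ) * K / m)) =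
      ∑ ℓ ∈ range K, (∑ h ∈ range K, ∑ k ∈ range m,
        (K : ℂ)⁻¹ * (m : ℂ)⁻¹ * C h * ((𝐞 ((h : ℝ) * ℓ / K) : ℂ) * (𝐞 ((k : ℝ) * ℓ / m) : ℂ))) • F ℓ := by
  have hK0 : (K : ℝ) ≠ 0 := by exact_mod_cast hK.ne'
  have hm0 : (m : ℝ) ≠ 0 := by exact_mod_cast hm.ne'
  have key : ∀ ℓ h k : ℕ, (𝐞 (-((ℓ : ℝ) * (-(h : ℝ) - (k : ℝ) * K / m) / K)) : ℂ) =
      (𝐞 ((h : ℝ) * ℓ / K) : ℂ) * (𝐞 ((k : ℝ) * ℓ / m) : ℂ) := by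
    intro ℓ h k
    rw [coe_fourierChar_mul]
    congr 2
    field_simp
    ring
  -- expand each `h`-summand into a double sum over `ℓ, k`
  have hR : ∀ h : ℕ, C h • (((m : ℂ)⁻¹) • ∑ k ∈ range m, dftR K F (-(h : ℝ) - (k : ℝ) * K / m)) =
      ∑ ℓ ∈ range K, ∑ k ∈ range m,
        ((K : ℂ)⁻¹ * (m : ℂ)⁻¹ * C h * ((𝐞 ((h : ℝ) * ℓ / K) : ℂ) * (𝐞 ((k : ℝ) * ℓ / m) : ℂ))) • F ℓ := by
    intro h
    simp only [dftR_apply, smul_sum, smul_smul]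
    rw [sum_comm]
    refine sum_congr rfl fun ℓ _ => sum_congr rfl fun k _ => ?_
    rw [key]
    congr 1
    ring
  rw [sum_congr rfl fun h _ => hR h, sum_comm]
  refine sum_congr rfl fun ℓ _ => ?_
  rw [sum_smul]
  refine sum_congr rfl fun h _ => ?_
  rw [sum_smul]

/-- **The completed identity** (Mauduit–Rivat, the first two displays of the proof of Prop. 1):
for `(A, B] ⊆ [0, K)`, `K, m ≥ 1`,
`∑_{ℓ∈(A,B], m∣ℓ} F(ℓ) = ∑_{h<K} (∑_{s∈(A,B]} e(−hs/K)) • m⁻¹ ∑_{k<m} dftR K F (−h − kK/m)`.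
[cite: MauduitRivat2015, Prop. 1 (proof, display before (31))] -/
theorem sum_filter_dvd_eq_dft {K m A B : ℕ} (hK : 0 < K) (hm : 0 < m) (hB : B < K) (F : ℕ → E) :
    ∑ ℓ ∈ (Ioc A B).filter (fun ℓ => m ∣ ℓ), F ℓ =
      ∑ h ∈ range K, (∑ s ∈ Ioc A B, (𝐞 (-((h : ℝ) * s / K)) : ℂ)) •
        (((m : ℂ)⁻¹) • ∑ k ∈ range m, dftR K F (-(h : ℝ) - (k : ℝ) * K / m)) := by
  rw [sum_smul_dftR_shift_eq hK hm]
  -- Step 1: `∑_{ℓ ∈ (A,B], m ∣ ℓ} F ℓ = ∑_{ℓ<K} ([A < ℓ ≤ B] · [m ∣ ℓ]) • F ℓ`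
  have hsub : Ioc A B ⊆ range K := fun ℓ hℓ => by
    rw [mem_Ioc] at hℓ; rw [mem_range]; omega
  have h1 : ∑ ℓ ∈ (Ioc A B).filter (fun ℓ => m ∣ ℓ), F ℓ =
      ∑ ℓ ∈ range K, ((if (A : ℤ) < (ℓ : ℤ) ∧ (ℓ : ℤ) ≤ (B : ℤ) then (1 : ℂ) else 0) *
        (if m ∣ ℓ then (1 : ℂ) else 0)) • F ℓ := by
    rw [sum_filter, ← sum_subset hsub]
    · refine sum_congr rfl fun ℓ hℓ => ?_
      rw [mem_Ioc] at hℓ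
      have hc : (A : ℤ) < (ℓ : ℤ) ∧ (ℓ : ℤ) ≤ (B : ℤ) := by omega
      rw [if_pos hc, one_mul]
      split_ifs <;> simp
    · intro ℓ _ hℓ
      rw [mem_Ioc] at hℓ
      have hc : ¬((A : ℤ) < (ℓ : ℤ) ∧ (ℓ : ℤ) ≤ (B : ℤ)) := by omega
      rw [if_neg hc, zero_mul, zero_smul]
  rw [h1]
  -- Step 2: expand both indicators into character sums
  refine sum_congr rfl fun ℓ hℓ => ?_
  have hℓK := mem_range.1 hℓ
  have hclose : ∀ s ∈ Ioc A B, |(ℓ : ℤ) - (s : ℤ)| < K := by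
    intro s hs
    have hsK := mem_range.1 (hsub hs)
    rw [abs_sub_lt_iff]; constructor <;> omega
  rw [indicator_Ioc_eq_sum_e hK A B (ℓ : ℤ) hclose, ← inv_mul_sum_range_fourierChar_div_nat hm ℓ]
  congr 1
  rw [mul_sum, mul_sum, sum_mul_sum]
  refine sum_congr rfl fun h _ => sum_congr rfl fun k _ => ?_
  push_cast
  ring

/-- **Mauduit–Rivat (31)**, vector-valued: for `(A, B] ⊆ [0, K)`, `B − A ≤ V`, `K, m ≥ 1`,
`‖∑_{ℓ∈(A,B], m∣ℓ} F(ℓ)‖ ≤ ∑_{h<K} min(V, 1/(2‖h/K‖)) · m⁻¹ ∑_{k<m} ‖dftR K F (−h − kK/m)‖`.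
[cite: MauduitRivat2015, (31)] -/
theorem norm_sum_filter_dvd_le {K m A B : ℕ} (hK : 0 < K) (hm : 0 < m) (hB : B < K) {V : ℝ}
    (hV : ((B - A : ℕ) : ℝ) ≤ V) (F : ℕ → E) :
    ‖∑ ℓ ∈ (Ioc A B).filter (fun ℓ => m ∣ ℓ), F ℓ‖ ≤
      ∑ h ∈ range K, geomBound V ((h : ℝ) / K) *
        ((m : ℝ)⁻¹ * ∑ k ∈ range m, ‖dftR K F (-(h : ℝ) - (k : ℝ) * K / m)‖) := by
  rw [sum_filter_dvd_eq_dft hK hm hB F]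
  refine (norm_sum_le _ _).trans (sum_le_sum fun h _ => ?_)
  rw [norm_smul, norm_smul, norm_inv, Complex.norm_natCast]
  have hC : ‖∑ s ∈ Ioc A B, (𝐞 (-((h : ℝ) * s / K)) : ℂ)‖ ≤ geomBound V ((h : ℝ) / K) := by
    have e : ∑ s ∈ Ioc A B, (𝐞 (-((h : ℝ) * s / K)) : ℂ) =
        ∑ s ∈ Ioc A B, (𝐞 ((s : ℝ) * (-(h : ℝ) / K)) : ℂ) := by
      refine sum_congr rfl fun s _ => ?_
      congr 2
      ring
    rw [e, ← geomBound_neg, ← neg_div]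
    exact norm_sum_Ioc_fourierChar_le_geomBound _ hV
  have hV0 : 0 ≤ V := le_trans (Nat.cast_nonneg _) hV
  gcongr
  · exact geomBound_nonneg hV0 _
  · exact norm_sum_le _ _

/-- **Mauduit–Rivat (32)**, vector-valued: if `∑_{m∈Ms} m⁻¹ ∑_{k<m} ‖dftR K F (t − kK/m)‖ ≤ S`
for every real `t` (`Ms` a finite set of moduli `m ≥ 1`), then for `(A, B] ⊆ [0, K)`,
`B − A ≤ V`, `∑_{m∈Ms} ‖∑_{ℓ∈(A,B], m∣ℓ} F(ℓ)‖ ≤ (2V + K(1 + log K)) · S`.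
[cite: MauduitRivat2015, (32)] -/
theorem sum_norm_sum_filter_dvd_le {K A B : ℕ} (hK : 0 < K) (hB : B < K) {V : ℝ} (hV0 : 0 ≤ V)
    (hV : ((B - A : ℕ) : ℝ) ≤ V) {Ms : Finset ℕ} (hMs : ∀ m ∈ Ms, 0 < m) (F : ℕ → E) {S : ℝ}
    (hS : ∀ t : ℝ, ∑ m ∈ Ms, (m : ℝ)⁻¹ * ∑ k ∈ range m, ‖dftR K F (t - (k : ℝ) * K / m)‖ ≤ S) :
    ∑ m ∈ Ms, ‖∑ ℓ ∈ (Ioc A B).filter (fun ℓ => m ∣ ℓ), F ℓ‖ ≤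
      (2 * V + K * (1 + Real.log K)) * S := by
  have hS0 : 0 ≤ S := le_trans (sum_nonneg fun m _ => by positivity) (hS 0)
  calc ∑ m ∈ Ms, ‖∑ ℓ ∈ (Ioc A B).filter (fun ℓ => m ∣ ℓ), F ℓ‖
      ≤ ∑ m ∈ Ms, ∑ h ∈ range K, geomBound V ((h : ℝ) / K) *
          ((m : ℝ)⁻¹ * ∑ k ∈ range m, ‖dftR K F (-(h : ℝ) - (k : ℝ) * K / m)‖) :=
        sum_le_sum fun m hm => norm_sum_filter_dvd_le hK (hMs m hm) hB hV F
    _ = ∑ h ∈ range K, geomBound V ((h : ℝ) / K) *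
          ∑ m ∈ Ms, (m : ℝ)⁻¹ * ∑ k ∈ range m, ‖dftR K F (-(h : ℝ) - (k : ℝ) * K / m)‖ := by
        rw [sum_comm]
        exact sum_congr rfl fun h _ => by rw [mul_sum]
    _ ≤ ∑ h ∈ range K, geomBound V ((h : ℝ) / K) * S :=
        sum_le_sum fun h _ => mul_le_mul_of_nonneg_left (hS _) (geomBound_nonneg hV0 _)
    _ = (∑ h ∈ range K, geomBound V ((h : ℝ) / K)) * S := by rw [sum_mul]
    _ ≤ (2 * V + K * (1 + Real.log K)) * S :=
        mul_le_mul_of_nonneg_right (sum_range_geomBound_div_le hK hV0) hS0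

end Literature.NumberTheory.LFunctions.MauduitRivat
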